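import Summits.AtomisticToContinuum.HydrodynamicLimit.Theorems.RelayRaceLocalityLightConeInLawSVCVarReduction
import Summits.AtomisticToContinuum.HydrodynamicLimit.Theorems.RelayRaceLocalityLightConeInLawStubTimeZero

/-!
# `stub_var` (line `susceptibility-variance-continuity`, crux `LightConeInLaw`, stmt-AtomisticToContinuum-12500):
the ONE missing fact, typed

Worker stub_var (lead a1), 2026-08-16. Verdict of the audit: `stub_var` is honestly typed (no junk, not vacuous,
flows pinned a.e. by `HardSphereFlow.flow_eq_ae_holds`), TRUE for the ideal gas, an unformalised static
cluster-expansion fact at `t = 0` / at global equilibrium, and OPEN at `t > 0` for inhomogeneous profiles. It is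
NOT provable from the tree today. Everything hinges on the following single statement, given here in two forms.

* `PoissonisedFieldMSq` — **THE HINGE (dynamic form).** In the exact quantifier frame of `stub_var` (same `η₀, M`,
  profile, `σ₀`, Euler solution and tie, flow family `Ψ`, guarded `t`, `χ`; but `F`-free): on the mean-count
  window there are centres `c_{N,μ} ∈ ℝ × V3 × ℝ` with
  `Σₙ p_{N,μ}(n) · E_{π_{N,n}} dist(X_{n,t}, c_{N,μ})² ≤ C/(N+1)`,
  `X_{n,t}(z) = (σ₂³ ρ_n(χ)(Ψₜz), σ₂³ • j_n(χ)(Ψₜz), σ₂³ e_n(χ)(Ψₜz))` the reduced field triple — i.e. CLT-RATE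
  MEAN-SQUARE CONCENTRATION OF THE HYDRODYNAMIC FIELDS AT TIME `t` UNDER THE POISSONISED (GRAND-CANONICAL) LOCAL
  GIBBS STATE ("bounded `L²` amplification of the fluctuation field by the deterministic dynamics", Spohn 1991
  Part II §7.1; = rev 1's `GCVarianceBound` with free centres). Stated junk-free (`∫⁻`, `ℝ≥0∞` series).
  `PoissonisedFieldMSq → stub_var` is KERNEL-CHECKED: `stub_var_of_poissonisedFieldMSq` below, via the landed
  helper `LightConeInLawSVC.Var.wVar_canonicalMean_le_of_msq` (`Theorems/RelayRaceLocalityLightConeInLawSVCVarReduction.lean`).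
  STATUS: OPEN at `t > 0` for every deterministic interacting gas (it is the "determinism half" of the
  hydrodynamic limit at rate `1/N`); true for the ideal gas; at global equilibrium (constant profiles, where the
  constant Euler solution is global and the canonical laws are flow-invariant, `map_flow_particleLaw_const`) it
  reduces for every `t` to the static form below.
* `StaticFieldMSq` — **its `t = 0` slice (statics; in print, unformalised).** Flow-free and Euler-free: the same
  mean-square bound for the UNEVOLVED reduced fields under the Poissonised canonical family of the low-activity
  hard-sphere gas with a continuous local Gibbs profile. Content: `Var_GC(Σᵢ χ(xᵢ)) = O(N)` (integrated truncated
  two-point function of the grand-canonical hard-sphere gas bounded uniformly in the volume, low-activity cluster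
  expansion: Ruelle 1969 Ch. 4; canonical finite-size corrections `O(1/N)`: Lebowitz–Percus–Verlet 1967,
  Pulvirenti–Tsagkarogiannis 2012), Gaussian velocity moments, and `Var_p(n) = O(N)` for the random normalisation
  `n⁻¹`. NOT in the tree: the tree's canonical cluster expansion (`HardSphereEulerLLN`: `SmallDensity.tendsto_onePt`,
  `tendsto_twoPt`, `tendsto_variance`; `GeneralFamilyConcentration`) is qualitative / fixed-`δ` exponential, with no
  `O(1/N)` rate for the two-point function. By `canonicalMean_flow_zero` / `Φ₀ = id` a.e. it yields the `t = 0`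
  instances of `PoissonisedFieldMSq` (and, by Gibbs invariance, all `t` at global equilibrium).
-/

namespace Summit.AtomisticToContinuum.HydrodynamicLimit.Theorems.LightConeInLawSVC.Var

open scoped BigOperators Topology Classical ENNReal
open Filter Set MeasureTheory
open Literature.MathematicalPhysics.KineticTheory Literature.Analysis.FluidPDE Literature.Analysis.FunctionSpaces
open Summit.AtomisticToContinuum.HydrodynamicLimit.Theorems.LightConeInLawSketch
open Summit.AtomisticToContinuum.HydrodynamicLimit.Theorems.LightConeInLawSVC

noncomputable section

/-- **THE ONE MISSING FACT (dynamic form): CLT-rate Poissonised mean-square concentration of the reduced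
hydrodynamic fields at time `t`.** In the quantifier frame of `stub_var`: for every activity `μ > 0` and
`N ≥ N₀` whose mean count lies in `[(1−κ)(σ₂/σ₁)³(N+1), (1+κ)(σ₂/σ₁)³(N+1)]` there is a centre `c ∈ ℝ × V3 × ℝ` with
`Σₙ p_{N,μ}(n) ∫ dist(X_{n,t}(z), c)² dπ_{N,n}(z) ≤ C/(N+1)`, where `p_{N,μ} = countWeight`, `π_{N,n}` is the canonical
local Gibbs law of `n` spheres of diameter `hsDiameter σ₁ N`, and `X_{n,t}` the reduced field triple of `Ψ_t z`
against `χ`. OPEN for `t > 0`; see the module docstring. -/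
def PoissonisedFieldMSq : Prop :=
    ∃ η₀ : ℝ, 0 < η₀ ∧ ∀ M : ℝ, 0 < M →
    ∀ (a₂ θ₂ : T3 → ℝ) (u₂ : T3 → V3), Continuous a₂ → Continuous θ₂ → Continuous u₂ →
      (∀ x, 0 < a₂ x) → (∀ x, 0 < θ₂ x) →
    ∃ σ₀ : ℝ, 0 < σ₀ ∧ ∀ (σ₁ σ₂ : ℝ), 0 < σ₁ → σ₁ < σ₀ → 0 < σ₂ → σ₂ < σ₀ →
    ∀ (T₂ : ℝ) (ρ₂ Θ₂ : ℝ → T3 → ℝ) (U₂ : ℝ → T3 → V3), IsHardSphereEulerSolution σ₂ T₂ ρ₂ U₂ Θ₂ →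
    ∀ (m : ℕ → ℕ) (Φm : (N : ℕ) → HardSphereFlow G3 (hsDiameter σ₁ N) (m N)),
      Tendsto (fun N => (m N : ℝ) * hsDiameter σ₁ N ^ 3) atTop (𝓝 (σ₂ ^ 3)) →
      (∀ N, IsProbabilityMeasure (particleLaw (Φm N)
        (canonicalDensity G3 (hsDiameter σ₁ N) (m N) (localGibbsProfile a₂ u₂ θ₂)))) →
      LLNAt m (fun N => particleLaw (Φm N)
        (canonicalDensity G3 (hsDiameter σ₁ N) (m N) (localGibbsProfile a₂ u₂ θ₂))) Φm
        (ρ₂ 0) (U₂ 0) (Θ₂ 0) 0 →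
    ∀ Ψ : (N n : ℕ) → HardSphereFlow G3 (hsDiameter σ₁ N) n,
    ∀ t : ℝ, 0 ≤ t → t < T₂ →
      (∀ s ∈ Set.Icc 0 t, ∀ x, ρ₂ s x * σ₂ ^ 3 < η₀ ∧ Θ₂ s x ≤ M ∧ ‖U₂ s x‖ ≤ M) →
    ∀ χ : T3 → ℝ, Continuous χ →
    ∃ κ : ℝ, 0 < κ ∧ ∃ C : ℝ, ∃ N₀ : ℕ, ∀ μ : ℝ, 0 < μ → ∀ N : ℕ, N₀ ≤ N →
      (1 - κ) * ((σ₂ / σ₁) ^ 3 * ((N + 1 : ℕ) : ℝ)) ≤ meanCount σ₁ (localGibbsProfile a₂ u₂ θ₂) μ N →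
      meanCount σ₁ (localGibbsProfile a₂ u₂ θ₂) μ N ≤ (1 + κ) * ((σ₂ / σ₁) ^ 3 * ((N + 1 : ℕ) : ℝ)) →
      ∃ c : ℝ × V3 × ℝ,
        ∑' n, ENNReal.ofReal (countWeight σ₁ (localGibbsProfile a₂ u₂ θ₂) μ N n) *
            ∫⁻ z, ENNReal.ofReal (dist
                (σ₂ ^ 3 * empiricalDensityField ((Ψ N n).flow t z) χ,
                  (σ₂ ^ 3) • empiricalMomentumField ((Ψ N n).flow t z) χ,
                  σ₂ ^ 3 * empiricalEnergyField ((Ψ N n).flow t z) χ) c ^ 2)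
              ∂(particleLaw (Ψ N n) (canonicalDensity G3 (hsDiameter σ₁ N) n (localGibbsProfile a₂ u₂ θ₂))) ≤
          ENNReal.ofReal (C / ((N + 1 : ℕ) : ℝ))

/-- **The `t = 0` slice of the hinge (STATICS; in print via the low-activity cluster expansion, unformalised):
CLT-rate Poissonised mean-square concentration of the UNEVOLVED reduced fields.** Flow-free and Euler-free: for a
continuous positive profile and small `σ₁, σ₂`, on the mean-count window there are centres `c` with
`Σₙ p_{N,μ}(n) ∫ dist(X_n(z), c)² dπ_{N,n}(z) ≤ C/(N+1)`, `X_n(z)` the reduced field triple of the configuration `z`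
itself (the flow argument `Ψ N n` only fixes the phase space of `particleLaw`). -/
def StaticFieldMSq : Prop :=
    ∀ (a₂ θ₂ : T3 → ℝ) (u₂ : T3 → V3), Continuous a₂ → Continuous θ₂ → Continuous u₂ →
      (∀ x, 0 < a₂ x) → (∀ x, 0 < θ₂ x) →
    ∃ σ₀ : ℝ, 0 < σ₀ ∧ ∀ (σ₁ σ₂ : ℝ), 0 < σ₁ → σ₁ < σ₀ → 0 < σ₂ → σ₂ < σ₀ →
    ∀ Ψ : (N n : ℕ) → HardSphereFlow G3 (hsDiameter σ₁ N) n,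
    ∀ χ : T3 → ℝ, Continuous χ →
    ∃ κ : ℝ, 0 < κ ∧ ∃ C : ℝ, ∃ N₀ : ℕ, ∀ μ : ℝ, 0 < μ → ∀ N : ℕ, N₀ ≤ N →
      (1 - κ) * ((σ₂ / σ₁) ^ 3 * ((N + 1 : ℕ) : ℝ)) ≤ meanCount σ₁ (localGibbsProfile a₂ u₂ θ₂) μ N →
      meanCount σ₁ (localGibbsProfile a₂ u₂ θ₂) μ N ≤ (1 + κ) * ((σ₂ / σ₁) ^ 3 * ((N + 1 : ℕ) : ℝ)) →
      ∃ c : ℝ × V3 × ℝ,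
        ∑' n, ENNReal.ofReal (countWeight σ₁ (localGibbsProfile a₂ u₂ θ₂) μ N n) *
            ∫⁻ z, ENNReal.ofReal (dist
                (σ₂ ^ 3 * empiricalDensityField z χ,
                  (σ₂ ^ 3) • empiricalMomentumField z χ,
                  σ₂ ^ 3 * empiricalEnergyField z χ) c ^ 2)
              ∂(particleLaw (Ψ N n) (canonicalDensity G3 (hsDiameter σ₁ N) n (localGibbsProfile a₂ u₂ θ₂))) ≤
          ENNReal.ofReal (C / ((N + 1 : ℕ) : ℝ))


/-! ### Consequences (kernel-checked): the hinge implies `stub_var`; its static slice implies `stub_var` at `t = 0` -/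

open Summit.AtomisticToContinuum.HydrodynamicLimit.Theorems.LightConeInLawSketch.TimeZero in
/-- The registered statement of `stub_var` (byte-copy of the skeleton's `Holds.stub_var` type, rev 2). -/
def StubVar : Prop :=
    ∃ η₀ : ℝ, 0 < η₀ ∧ ∀ M : ℝ, 0 < M →
    ∀ (a₂ θ₂ : T3 → ℝ) (u₂ : T3 → V3), Continuous a₂ → Continuous θ₂ → Continuous u₂ →
      (∀ x, 0 < a₂ x) → (∀ x, 0 < θ₂ x) →
    ∃ σ₀ : ℝ, 0 < σ₀ ∧ ∀ (σ₁ σ₂ : ℝ), 0 < σ₁ → σ₁ < σ₀ → 0 < σ₂ → σ₂ < σ₀ →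
    ∀ (T₂ : ℝ) (ρ₂ Θ₂ : ℝ → T3 → ℝ) (U₂ : ℝ → T3 → V3), IsHardSphereEulerSolution σ₂ T₂ ρ₂ U₂ Θ₂ →
    ∀ (m : ℕ → ℕ) (Φm : (N : ℕ) → HardSphereFlow G3 (hsDiameter σ₁ N) (m N)),
      Tendsto (fun N => (m N : ℝ) * hsDiameter σ₁ N ^ 3) atTop (𝓝 (σ₂ ^ 3)) →
      (∀ N, IsProbabilityMeasure (particleLaw (Φm N)
        (canonicalDensity G3 (hsDiameter σ₁ N) (m N) (localGibbsProfile a₂ u₂ θ₂)))) →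
      LLNAt m (fun N => particleLaw (Φm N)
        (canonicalDensity G3 (hsDiameter σ₁ N) (m N) (localGibbsProfile a₂ u₂ θ₂))) Φm
        (ρ₂ 0) (U₂ 0) (Θ₂ 0) 0 →
    ∀ Ψ : (N n : ℕ) → HardSphereFlow G3 (hsDiameter σ₁ N) n,
    ∀ t : ℝ, 0 ≤ t → t < T₂ →
      (∀ s ∈ Set.Icc 0 t, ∀ x, ρ₂ s x * σ₂ ^ 3 < η₀ ∧ Θ₂ s x ≤ M ∧ ‖U₂ s x‖ ≤ M) →
    ∀ χ : T3 → ℝ, Continuous χ → ∀ F : ℝ × V3 × ℝ → ℝ, LipschitzWith 1 F → (∀ p, |F p| ≤ 1) →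
    ∃ κ : ℝ, 0 < κ ∧ ∃ C : ℝ, ∃ N₀ : ℕ, ∀ μ : ℝ, 0 < μ → ∀ N : ℕ, N₀ ≤ N →
      (1 - κ) * ((σ₂ / σ₁) ^ 3 * ((N + 1 : ℕ) : ℝ)) ≤ meanCount σ₁ (localGibbsProfile a₂ u₂ θ₂) μ N →
      meanCount σ₁ (localGibbsProfile a₂ u₂ θ₂) μ N ≤ (1 + κ) * ((σ₂ / σ₁) ^ 3 * ((N + 1 : ℕ) : ℝ)) →
      ((N + 1 : ℕ) : ℝ) *
        (wMean (canonicalWeights σ₁ (localGibbsProfile a₂ u₂ θ₂) N)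
            (fun n => (canonicalMean σ₁ (localGibbsProfile a₂ u₂ θ₂) N n (Ψ N n)
              (fun z => F (σ₂ ^ 3 * empiricalDensityField ((Ψ N n).flow t z) χ,
                (σ₂ ^ 3) • empiricalMomentumField ((Ψ N n).flow t z) χ,
                σ₂ ^ 3 * empiricalEnergyField ((Ψ N n).flow t z) χ))) ^ 2) μ -
          wMean (canonicalWeights σ₁ (localGibbsProfile a₂ u₂ θ₂) N)
            (fun n => canonicalMean σ₁ (localGibbsProfile a₂ u₂ θ₂) N n (Ψ N n)
              (fun z => F (σ₂ ^ 3 * empiricalDensityField ((Ψ N n).flow t z) χ,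
                (σ₂ ^ 3) • empiricalMomentumField ((Ψ N n).flow t z) χ,
                σ₂ ^ 3 * empiricalEnergyField ((Ψ N n).flow t z) χ))) μ ^ 2) ≤ C

/-- **THE HINGE IMPLIES `stub_var`** (kernel-checked): instantiate `PoissonisedFieldMSq` at the same data, and
at each `(μ, N)` apply the landed reduction `wVar_canonicalMean_le_of_msq` with `X n z :=` the reduced field triple
of `(Ψ N n).flow t z` (measurable, `measurable_reducedTriple`), the centre `c` the hinge provides and
`B := max C 0 / (N+1)`. [folklore] -/
theorem stub_var_of_poissonisedFieldMSq (h : PoissonisedFieldMSq) : StubVar := by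
  obtain ⟨η₀, hη₀, H⟩ := h
  refine ⟨η₀, hη₀, fun M hM a₂ θ₂ u₂ ha hθ hu ha0 hθ0 => ?_⟩
  obtain ⟨σ₀, hσ₀, Hσ⟩ := H M hM a₂ θ₂ u₂ ha hθ hu ha0 hθ0
  refine ⟨σ₀, hσ₀, ?_⟩
  intro σ₁ σ₂ hσ₁ hσ₁' hσ₂ hσ₂' T₂ ρ₂ Θ₂ U₂ hsol m Φm hm hPm hLm Ψ t ht htT hguard χ hχ F hF hFb
  obtain ⟨κ, hκ, C, N₀, HC⟩ :=
    Hσ σ₁ σ₂ hσ₁ hσ₁' hσ₂ hσ₂' T₂ ρ₂ Θ₂ U₂ hsol m Φm hm hPm hLm Ψ t ht htT hguard χ hχ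
  refine ⟨κ, hκ, max C 0, N₀, fun μ hμ N hN hlo hhi => ?_⟩
  obtain ⟨c, hc⟩ := HC μ hμ N hN hlo hhi
  have hN1 : (0 : ℝ) < ((N + 1 : ℕ) : ℝ) := by positivity
  have hc' := hc.trans (ENNReal.ofReal_le_ofReal (div_le_div_of_nonneg_right (le_max_left C 0) hN1.le))
  have key := wVar_canonicalMean_le_of_msq a₂ θ₂ u₂ ha hθ hu (fun x => (ha0 x).le) hθ0 σ₁ N (Ψ N) μ hμ
    (fun n z => (σ₂ ^ 3 * empiricalDensityField ((Ψ N n).flow t z) χ,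
      (σ₂ ^ 3) • empiricalMomentumField ((Ψ N n).flow t z) χ,
      σ₂ ^ 3 * empiricalEnergyField ((Ψ N n).flow t z) χ))
    (fun n => LightConeInLawSketch.TimeZero.measurable_reducedTriple (Ψ N n) σ₂ t hχ) F hF hFb c
    (max C 0 / ((N + 1 : ℕ) : ℝ)) (by positivity) hc'
  calc _ ≤ ((N + 1 : ℕ) : ℝ) * (max C 0 / ((N + 1 : ℕ) : ℝ)) := mul_le_mul_of_nonneg_left key hN1.le
    _ = max C 0 := mul_div_cancel₀ _ hN1.ne'

/-- `Φ₀ = id` almost surely under the canonical law: lower integrals of `G ∘ Φ₀` and of `G` agree. [folklore] -/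
theorem lintegral_flow_zero_congr {ε : ℝ} {n : ℕ} (Ψ : HardSphereFlow G3 ε n) (f : T3 × V3 → ℝ)
    (G : Config n (Fin 3) T3 → ℝ≥0∞) :
    ∫⁻ z, G (Ψ.flow 0 z) ∂(particleLaw Ψ (canonicalDensity G3 ε n f)) =
      ∫⁻ z, G z ∂(particleLaw Ψ (canonicalDensity G3 ε n f)) := by
  rw [particleLaw_eq]
  refine lintegral_congr_ae ?_
  have hac : (liouville G3 n ε).withDensity (fun z => ENNReal.ofReal (canonicalDensity G3 ε n f z)) ≪
      liouville G3 n ε := withDensity_absolutelyContinuous _ _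
  filter_upwards [hac.ae_le Ψ.ae_mem_good] with z hz
  rw [Ψ.flow_zero z hz]

/-- The registered statement of `stub_var` SPECIALISED TO `t = 0` (the quantifier `∀ t, 0 ≤ t → t < T₂ →`
replaced by `0 < T₂ →`, and `t := 0` in guards and fields). -/
def StubVarAtZero : Prop :=
    ∃ η₀ : ℝ, 0 < η₀ ∧ ∀ M : ℝ, 0 < M →
    ∀ (a₂ θ₂ : T3 → ℝ) (u₂ : T3 → V3), Continuous a₂ → Continuous θ₂ → Continuous u₂ →
      (∀ x, 0 < a₂ x) → (∀ x, 0 < θ₂ x) →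
    ∃ σ₀ : ℝ, 0 < σ₀ ∧ ∀ (σ₁ σ₂ : ℝ), 0 < σ₁ → σ₁ < σ₀ → 0 < σ₂ → σ₂ < σ₀ →
    ∀ (T₂ : ℝ) (ρ₂ Θ₂ : ℝ → T3 → ℝ) (U₂ : ℝ → T3 → V3), IsHardSphereEulerSolution σ₂ T₂ ρ₂ U₂ Θ₂ →
    ∀ (m : ℕ → ℕ) (Φm : (N : ℕ) → HardSphereFlow G3 (hsDiameter σ₁ N) (m N)),
      Tendsto (fun N => (m N : ℝ) * hsDiameter σ₁ N ^ 3) atTop (𝓝 (σ₂ ^ 3)) →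
      (∀ N, IsProbabilityMeasure (particleLaw (Φm N)
        (canonicalDensity G3 (hsDiameter σ₁ N) (m N) (localGibbsProfile a₂ u₂ θ₂)))) →
      LLNAt m (fun N => particleLaw (Φm N)
        (canonicalDensity G3 (hsDiameter σ₁ N) (m N) (localGibbsProfile a₂ u₂ θ₂))) Φm
        (ρ₂ 0) (U₂ 0) (Θ₂ 0) 0 →
    ∀ Ψ : (N n : ℕ) → HardSphereFlow G3 (hsDiameter σ₁ N) n,
    0 < T₂ →
      (∀ s ∈ Set.Icc (0 : ℝ) 0, ∀ x, ρ₂ s x * σ₂ ^ 3 < η₀ ∧ Θ₂ s x ≤ M ∧ ‖U₂ s x‖ ≤ M) →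
    ∀ χ : T3 → ℝ, Continuous χ → ∀ F : ℝ × V3 × ℝ → ℝ, LipschitzWith 1 F → (∀ p, |F p| ≤ 1) →
    ∃ κ : ℝ, 0 < κ ∧ ∃ C : ℝ, ∃ N₀ : ℕ, ∀ μ : ℝ, 0 < μ → ∀ N : ℕ, N₀ ≤ N →
      (1 - κ) * ((σ₂ / σ₁) ^ 3 * ((N + 1 : ℕ) : ℝ)) ≤ meanCount σ₁ (localGibbsProfile a₂ u₂ θ₂) μ N →
      meanCount σ₁ (localGibbsProfile a₂ u₂ θ₂) μ N ≤ (1 + κ) * ((σ₂ / σ₁) ^ 3 * ((N + 1 : ℕ) : ℝ)) →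
      ((N + 1 : ℕ) : ℝ) *
        (wMean (canonicalWeights σ₁ (localGibbsProfile a₂ u₂ θ₂) N)
            (fun n => (canonicalMean σ₁ (localGibbsProfile a₂ u₂ θ₂) N n (Ψ N n)
              (fun z => F (σ₂ ^ 3 * empiricalDensityField ((Ψ N n).flow 0 z) χ,
                (σ₂ ^ 3) • empiricalMomentumField ((Ψ N n).flow 0 z) χ,
                σ₂ ^ 3 * empiricalEnergyField ((Ψ N n).flow 0 z) χ))) ^ 2) μ -
          wMean (canonicalWeights σ₁ (localGibbsProfile a₂ u₂ θ₂) N)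
            (fun n => canonicalMean σ₁ (localGibbsProfile a₂ u₂ θ₂) N n (Ψ N n)
              (fun z => F (σ₂ ^ 3 * empiricalDensityField ((Ψ N n).flow 0 z) χ,
                (σ₂ ^ 3) • empiricalMomentumField ((Ψ N n).flow 0 z) χ,
                σ₂ ^ 3 * empiricalEnergyField ((Ψ N n).flow 0 z) χ))) μ ^ 2) ≤ C

/-- **THE STATIC SLICE IMPLIES `stub_var` AT `t = 0`** (kernel-checked; no Euler solution, tie or guard is
used — at `t = 0` the stub is pure statics): `Φ₀ = id` a.s. turns the flow-free mean-square bound of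
`StaticFieldMSq` into the `t = 0` instance of the hinge, and `wVar_canonicalMean_le_of_msq` concludes.
(`η₀ := 1` is arbitrary.) [folklore] -/
theorem stubVarAtZero_of_staticFieldMSq (h : StaticFieldMSq) : StubVarAtZero := by
  refine ⟨1, one_pos, fun M _hM a₂ θ₂ u₂ ha hθ hu ha0 hθ0 => ?_⟩
  obtain ⟨σ₀, hσ₀, Hσ⟩ := h a₂ θ₂ u₂ ha hθ hu ha0 hθ0
  refine ⟨σ₀, hσ₀, ?_⟩
  intro σ₁ σ₂ hσ₁ hσ₁' hσ₂ hσ₂' T₂ ρ₂ Θ₂ U₂ _hsol m Φm _hm _hPm _hLm Ψ _hT _hguard χ hχ F hF hFb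
  obtain ⟨κ, hκ, C, N₀, HC⟩ := Hσ σ₁ σ₂ hσ₁ hσ₁' hσ₂ hσ₂' Ψ χ hχ
  refine ⟨κ, hκ, max C 0, N₀, fun μ hμ N hN hlo hhi => ?_⟩
  obtain ⟨c, hc⟩ := HC μ hμ N hN hlo hhi
  have hN1 : (0 : ℝ) < ((N + 1 : ℕ) : ℝ) := by positivity
  have hc' := hc.trans (ENNReal.ofReal_le_ofReal (div_le_div_of_nonneg_right (le_max_left C 0) hN1.le))
  -- move the flow-free bound to flow-time `0`
  have hc0 : ∑' n, ENNReal.ofReal (countWeight σ₁ (localGibbsProfile a₂ u₂ θ₂) μ N n) *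
      ∫⁻ z, ENNReal.ofReal (dist
          (σ₂ ^ 3 * empiricalDensityField ((Ψ N n).flow 0 z) χ,
            (σ₂ ^ 3) • empiricalMomentumField ((Ψ N n).flow 0 z) χ,
            σ₂ ^ 3 * empiricalEnergyField ((Ψ N n).flow 0 z) χ) c ^ 2)
        ∂(particleLaw (Ψ N n) (canonicalDensity G3 (hsDiameter σ₁ N) n (localGibbsProfile a₂ u₂ θ₂))) ≤
      ENNReal.ofReal (max C 0 / ((N + 1 : ℕ) : ℝ)) := by
    refine le_of_eq_of_le (tsum_congr fun n => ?_) hc'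
    rw [lintegral_flow_zero_congr (Ψ N n) (localGibbsProfile a₂ u₂ θ₂) (fun z => ENNReal.ofReal (dist
      (σ₂ ^ 3 * empiricalDensityField z χ, (σ₂ ^ 3) • empiricalMomentumField z χ,
        σ₂ ^ 3 * empiricalEnergyField z χ) c ^ 2))]
  have key := wVar_canonicalMean_le_of_msq a₂ θ₂ u₂ ha hθ hu (fun x => (ha0 x).le) hθ0 σ₁ N (Ψ N) μ hμ
    (fun n z => (σ₂ ^ 3 * empiricalDensityField ((Ψ N n).flow 0 z) χ,
      (σ₂ ^ 3) • empiricalMomentumField ((Ψ N n).flow 0 z) χ,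
      σ₂ ^ 3 * empiricalEnergyField ((Ψ N n).flow 0 z) χ))
    (fun n => LightConeInLawSketch.TimeZero.measurable_reducedTriple (Ψ N n) σ₂ 0 hχ) F hF hFb c
    (max C 0 / ((N + 1 : ℕ) : ℝ)) (by positivity) hc0
  calc _ ≤ ((N + 1 : ℕ) : ℝ) * (max C 0 / ((N + 1 : ℕ) : ℝ)) := mul_le_mul_of_nonneg_left key hN1.le
    _ = max C 0 := mul_div_cancel₀ _ hN1.ne'

end

end Summit.AtomisticToContinuum.HydrodynamicLimit.Theorems.LightConeInLawSVC.Var
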